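import Summits.ABC.ABC.Theses.PadicPrincipalCoreRadThree
import HarnessLib

/-!
# Route PadicPrincipalCoreRadThree, item `Assembly`: the route's own deciding theorem

`Summits/ABC/ABC/Theorems/PadicPrincipalCoreRadThreeAssembly.lean` — cell `abc-stewartyu`, seat p3.
`Assembly := TheoremAOne → WPM → GlueSpec → OddKappaDoorSpec → EpsShapeBoundThree` is literally the
planner's `closes` of the route file.
-/

set_option linter.dupNamespace false

namespace Summit.ABC.ABC.Theorems

/-- **Item `Assembly` of route PadicPrincipalCoreRadThree.** [folklore] -/
theorem padicPrincipalCoreRadThree_assembly_proof :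
    Summit.ABC.ABC.Theses.PadicPrincipalCoreRadThree.Assembly :=
  fun hA hM hG hO => Summit.ABC.ABC.Theses.PadicPrincipalCoreRadThree.closes hA hM hG hO

end Summit.ABC.ABC.Theorems
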